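import Literature.NumberTheory.Transcendental.RoySmallValueStep2Pkg
import Literature.NumberTheory.Transcendental.RoySmallValueLevels
import HarnessLib

/-!
# Roy's small value estimate for `𝔾ₐ × 𝔾ₘ` — the companion form `Q = ∑ tⁱ𝒟ⁱP̃` lies in (an enlargement of) Roy's body

Topic `Literature/NumberTheory/Transcendental`. Part of the formalisation of the proof of Roy 2013,
Theorem 1.1 (named fact `roy2013_thm_1_1`, `RoySmallValueEstimates.lean`), seat B. Source: D. Roy,
*A small value estimate for `𝔾ₐ × 𝔾ₘ`*, Mathematika 59 (2013) 333–363 = arXiv:1301.0663, §6,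
proof of Proposition 6.4 (p. 17):

> By Lemma 6.3, there exist integers `a₁, …, a_D` of absolute values at most `D` [here: `aᵢ = tⁱ`,
> `t ≤ D²`] such that `Q = ∑ aᵢ𝒟ⁱP` is relatively prime to `P`. [...] `‖Q‖ ≤ ∑ |aᵢ| ‖𝒟ⁱP‖ ≤ …`

In this development `Φ(P̃, Q, R)` is bounded by `prop_6_1`, which needs ALL THREE arguments in the
body `𝒞 = royBody D ξ η Y U T`. This file shows that the companion `Q = levelQ D P̃ t` of a level
package lies in `royBody D ξ η Y U T` as soon as the derivatives `𝒟ⁱP̃` (`1 ≤ i ≤ D`) lie in a body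
`royBody D ξ η Y₀ U₀ T` with `D t^D e^{Y₀} ≤ e^Y` and `D t^D e^{−U₀} ≤ e^{−U}`
(`levelQ_mem_royBody`) — the (harmless, polynomial in `D`) enlargement of the parameters absorbed
by the "for `D` large enough" of §7. Everything is proved; no definitions, no named facts.

## References

* [Roy2013] D. Roy, *A small value estimate for 𝔾ₐ × 𝔾ₘ*, Mathematika 59 (2013), 333–363
  (arXiv:1301.0663), §6, proof of Proposition 6.4 (the form `Q`).
-/

noncomputable section

open MvPolynomial Finset

namespace Literature.NumberTheory.Transcendental

namespace Roy2013

open Nesterenko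

/-- **`Q = ∑_{i=1}^{D} tⁱ𝒟ⁱP̃ ∈ royBody D ξ η Y U T`** when `𝒟ⁱP̃ ∈ royBody D ξ η Y₀ U₀ T` for
`1 ≤ i ≤ D` and `D t^D e^{Y₀} ≤ e^Y`, `D t^D e^{−U₀} ≤ e^{−U}` (`t ≥ 1`).
[cite: Roy2013, §6, proof of Proposition 6.4 (`‖Q‖ ≤ ∑|aᵢ|‖𝒟ⁱP‖`)] -/
theorem levelQ_mem_royBody {D : ℕ} {Pt : MvPolynomial (Fin 3) ℤ} {ξ η : ℂ} {Y₀ U₀ Y U : ℝ}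
    {T : ℕ} {t : ℕ} (ht : 1 ≤ t)
    (hmem : ∀ i ∈ Icc 1 D, homD^[i] (map (Int.castRingHom ℂ) Pt) ∈ royBody D ξ η Y₀ U₀ T)
    (hY : (D : ℝ) * (t : ℝ) ^ D * Real.exp Y₀ ≤ Real.exp Y)
    (hU : (D : ℝ) * (t : ℝ) ^ D * Real.exp (-U₀) ≤ Real.exp (-U)) :
    map (Int.castRingHom ℂ) (levelQ D Pt t) ∈ royBody D ξ η Y U T := by
  have ht1 : (1 : ℝ) ≤ t := by exact_mod_cast ht
  have htpow : ∀ i ∈ Icc 1 D, ((t : ℝ)) ^ i ≤ (t : ℝ) ^ D := fun i hi =>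
    pow_le_pow_right₀ ht1 (mem_Icc.mp hi).2
  have hcard : ((Icc 1 D).card : ℝ) = D := by simp
  rw [map_levelQ]
  refine ⟨?_, ?_, fun j hj => ?_⟩
  · -- homogeneity
    refine IsHomogeneous.sum _ _ _ fun i hi => ?_
    rw [smul_eq_C_mul]
    exact (hmem i hi).1.C_mul _
  · -- the norm
    calc maxNorm (∑ i ∈ Icc 1 D, ((t : ℂ) ^ i) • homD^[i] (map (Int.castRingHom ℂ) Pt))
        ≤ ∑ i ∈ Icc 1 D, maxNorm (((t : ℂ) ^ i) • homD^[i] (map (Int.castRingHom ℂ) Pt)) :=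
          maxNorm_sum_le _ _
      _ ≤ ∑ i ∈ Icc 1 D, (t : ℝ) ^ D * Real.exp Y₀ := by
          refine Finset.sum_le_sum fun i hi => ?_
          rw [smul_eq_C_mul, maxNorm_C_mul, norm_pow, Complex.norm_natCast]
          exact mul_le_mul (htpow i hi) (hmem i hi).2.1 (maxNorm_nonneg _) (by positivity)
      _ = (D : ℝ) * (t : ℝ) ^ D * Real.exp Y₀ := by rw [sum_const, nsmul_eq_mul, hcard, mul_assoc]
      _ ≤ Real.exp Y := hY
  · -- the values
    rw [iterate_homD_sum, map_sum]
    calc ‖∑ i ∈ Icc 1 D, aeval ![1, ξ, η] (homD^[j] (((t : ℂ) ^ i) • homD^[i] (map (Int.castRingHom ℂ) Pt)))‖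
        ≤ ∑ i ∈ Icc 1 D, ‖aeval ![1, ξ, η] (homD^[j] (((t : ℂ) ^ i) • homD^[i] (map (Int.castRingHom ℂ) Pt)))‖ :=
          norm_sum_le _ _
      _ ≤ ∑ i ∈ Icc 1 D, (t : ℝ) ^ D * Real.exp (-U₀) := by
          refine Finset.sum_le_sum fun i hi => ?_
          rw [iterate_homD_smul, map_smul, norm_smul, norm_pow, Complex.norm_natCast]
          exact mul_le_mul (htpow i hi) ((hmem i hi).2.2 j hj) (norm_nonneg _) (by positivity)
      _ = (D : ℝ) * (t : ℝ) ^ D * Real.exp (-U₀) := by rw [sum_const, nsmul_eq_mul, hcard, mul_assoc]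
      _ ≤ Real.exp (-U) := hU

end Roy2013

end Literature.NumberTheory.Transcendental
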